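import Mathlib
import Literature.NumberTheory.Sieve.IntervalResidueClassSieveSigned
import Literature.NumberTheory.Sieve.BombieriAsymptoticSieveMertens
import Literature.NumberTheory.Sieve.ParityBarrier
import Summits.Parity.GeneralizedHardyLittlewood.Theorems.ParityLeakOneFifthPlainSplitTwistedModel
import Summits.Parity.GeneralizedHardyLittlewood.Theorems.ParityLeakOneFifthPlainSplitTwistedRemainder
import Summits.Parity.GeneralizedHardyLittlewood.Theorems.ParityLeakOneFifthPlainSplitTwistedRemainderSum
import Summits.Parity.GeneralizedHardyLittlewood.Theorems.ParityLeakOneFifthPlainSplitTwistedPerD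
import HarnessLib

/-!
# Route ParityLeakOneFifth, crux `PlainSplit` (stmt-Parity-18382), skeleton `calib-split`:
# tools for stub `stub_roughLiouvilleTwistedSmall`, V — the signed sum `S_d`

For `1 ≤ d` free of primes `< y` (`w ≤ y`), `2 < z ≤ w ≤ L`:
`S_d = Σ_{n ∈ (x,2x], n z-rough, P⁻(n+2) ≥ w, d ∣ n+2} λ(n+2)` is `±Σ_k λ(k)` over
`k ∈ ((x+2)/d, (2x+2)/d]` with `k mod p ∉ K_p` (`p < w`; part I); the tree's signed interval
residue-class sieve (`IntervalClassSieve.abs_signedSum_le`, two classes per prime) bounds it by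
`C (x/d + 1) V' e^{−log L/log w} + L² + (remainder)` with `V' ≤ 2V(z)/log w` (part IV, Mertens)
and the remainder of part IV: `twisted_Sd_le`.
-/

namespace Summit.Parity.GeneralizedHardyLittlewood.Theorems.ParityLeakOneFifth

open Finset
open Literature.NumberTheory.Sieve

/-! ### The bound for one `d` -/

set_option maxHeartbeats 800000 in
/-- **The signed sum `S_d`.**  See the module docstring: for `1 ≤ d` free of primes `< y`,
`2 < z ≤ w ≤ L`, `w ≤ y`, the signed interval sieve with the classes `{0, 2d⁻¹ mod p}` (`p < z`),
`{0}` (`z ≤ p < w`) and Bombieri–Vinogradov for the remainder give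
`|S_d| ≤ C (x/d + 1)(2V(z)/log w) e^{−log L/log w} + L² + 2 C_BV ((2x+2)/d)(1 + log L)/ℓ³`. -/
theorem twisted_Sd_le {C Cb B X₀r ℓ : ℝ} (hC : 0 ≤ C) (hCb : 0 ≤ Cb) (hℓ : 0 < ℓ)
    (hFL : ∀ (X : ℕ) (Ω : ℕ → Finset ℕ),
      (∀ p : ℕ, p.Prime → ∀ r ∈ Ω p, r < p) → (∀ p : ℕ, p.Prime → #(Ω p) ≤ 2) →
      (∀ p : ℕ, p.Prime → #(Ω p) < p) →
      ∀ z L : ℝ, 2 ≤ z → z ≤ L → ∀ σ : ℕ → ℝ, (∀ n, |σ n| ≤ 1) →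
        |∑ n ∈ (Finset.Icc 1 X).filter (fun n : ℕ => ∀ p ∈ Nat.primesBelow ⌈z⌉₊, n % p ∉ Ω p),
            σ n| ≤
          C * X * (∏ p ∈ Nat.primesBelow ⌈z⌉₊, (1 - (#(Ω p) : ℝ) / p)) *
              Real.exp (-(Real.log L / Real.log z)) + L ^ 2 +
          ∑ d ∈ (primesProdBelow z).divisors.filter (fun d : ℕ => (d : ℝ) ≤ L),
            ∑ c ∈ (Finset.range d).filter (fun c : ℕ => ∀ q ∈ d.primeFactors, c % q ∈ Ω q),
              |∑ n ∈ (Finset.Icc 1 X).filter (fun n : ℕ => n % d = c), σ n|)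
    (hBV : ∀ X : ℝ, X₀r ≤ X → ∀ Q : ℕ, (Q : ℝ) ≤ X ^ (1 / 2 : ℝ) / Real.log X ^ B →
      ∀ N : ℕ → ℕ, (∀ q, (N q : ℝ) ≤ X) → ∀ a : (q : ℕ) → ZMod q,
      (∀ q ∈ Finset.Icc 1 Q, IsUnit (a q)) →
        ∑ q ∈ Finset.Icc 1 Q, |∑ m ∈ (Finset.Icc 1 (N q)).filter (fun m : ℕ => (m : ZMod q) = a q),
          (ArithmeticFunction.liouville m : ℝ)| ≤ Cb * X / Real.log X ^ (3 : ℝ))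
    {x d : ℕ} {z w L y : ℝ} (hx : 1 ≤ x) (hd : 1 ≤ d) (hz : 2 < z) (hzw : z ≤ w) (hwL : w ≤ L)
    (hwy : w ≤ y) (hdr : ∀ p ∈ d.primeFactors, y ≤ (p : ℝ))
    (hlev : ∀ g ∈ Finset.Icc 1 ⌊L⌋₊, X₀r ≤ (2 * (x : ℝ) + 2) / ((d : ℝ) * g) ∧
      ((⌊L⌋₊ / g : ℕ) : ℝ) ≤ ((2 * (x : ℝ) + 2) / ((d : ℝ) * g)) ^ (1 / 2 : ℝ) /
        Real.log ((2 * (x : ℝ) + 2) / ((d : ℝ) * g)) ^ B ∧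
      ℓ ≤ Real.log ((2 * (x : ℝ) + 2) / ((d : ℝ) * g))) :
    |∑ n ∈ (Finset.Ioc x (2 * x)).filter (fun n : ℕ => ((∀ p ∈ n.primeFactors, z ≤ (p : ℝ)) ∧
        w ≤ ((n + 2).minFac : ℝ)) ∧ d ∣ n + 2), (ArithmeticFunction.liouville (n + 2) : ℝ)| ≤
      C * ((x : ℝ) / d + 1) * (2 * (∏ p ∈ (Finset.range ⌈z⌉₊).filter Nat.Prime, (1 - 1 / (p : ℝ))) /
        Real.log w) * Real.exp (-(Real.log L / Real.log w)) + L ^ 2 +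
      2 * Cb * ((2 * (x : ℝ) + 2) / d) * (1 + Real.log L) / ℓ ^ 3 := by
  have hd0 : 0 < d := hd
  have hd' : (0 : ℝ) < d := by exact_mod_cast hd0
  have hw2 : 2 ≤ w := by linarith
  have hw1 : 1 < w := by linarith
  have hL1 : 1 ≤ L := by linarith
  have hdw : ∀ p : ℕ, p.Prime → (p : ℝ) < w → ¬ p ∣ d := by
    intro p hp hpw hpd
    have := hdr p (Nat.mem_primeFactors.2 ⟨hp, hpd, by omega⟩)
    linarith
  set K₀ := (x + 2) / d with hK₀
  set K₁ := (2 * x + 2) / d with hK₁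
  have hK : K₀ ≤ K₁ := Nat.div_le_div_right (by omega)
  have hK₁r : (K₁ : ℝ) ≤ (2 * (x : ℝ) + 2) / d := by
    have : ((2 * x + 2 : ℕ) : ℝ) = 2 * (x : ℝ) + 2 := by push_cast; ring
    rw [← this]; exact Nat.cast_div_le
  -- Step C: `n + 2 = dk`
  have hC1 : ∑ n ∈ (Finset.Ioc x (2 * x)).filter (fun n : ℕ => ((∀ p ∈ n.primeFactors, z ≤ (p : ℝ)) ∧
        w ≤ ((n + 2).minFac : ℝ)) ∧ d ∣ n + 2), (ArithmeticFunction.liouville (n + 2) : ℝ) =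
      ∑ k ∈ (Finset.Ioc K₀ K₁).filter (fun k : ℕ => (∀ p ∈ (d * k - (2 : ℕ)).primeFactors, z ≤ (p : ℝ)) ∧
        w ≤ ((d * k).minFac : ℝ)), (ArithmeticFunction.liouville (d * k) : ℝ) := by
    have e := sum_filter_dvd_shift_eq x hd0 (fun m : ℕ => (∀ p ∈ (m - (2 : ℕ)).primeFactors, z ≤ (p : ℝ)) ∧
      w ≤ (m.minFac : ℝ)) (fun m => (ArithmeticFunction.liouville m : ℝ))
    rw [← e]
    exact Finset.sum_congr (by ext n; simp only [Finset.mem_filter, Nat.add_sub_cancel])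
      fun _ _ => rfl
  have hC2 : ∑ k ∈ (Finset.Ioc K₀ K₁).filter (fun k : ℕ => (∀ p ∈ (d * k - (2 : ℕ)).primeFactors,
        z ≤ (p : ℝ)) ∧ w ≤ ((d * k).minFac : ℝ)), (ArithmeticFunction.liouville (d * k) : ℝ) =
      (ArithmeticFunction.liouville d : ℝ) * ∑ k ∈ (Finset.Ioc K₀ K₁).filter (fun k : ℕ =>
        (∀ p ∈ (d * k - (2 : ℕ)).primeFactors, z ≤ (p : ℝ)) ∧ w ≤ ((d * k).minFac : ℝ)),
        (ArithmeticFunction.liouville k : ℝ) := by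
    rw [Finset.mul_sum]
    refine Finset.sum_congr rfl fun k hk => ?_
    rw [Finset.mem_filter, Finset.mem_Ioc] at hk
    exact liouville_mul' (by omega) (pos_of_gt hk.1.1).ne'
  -- the classes
  set t : ℕ → ℕ := fun p => ((2 : ZMod p) * ((d : ZMod p))⁻¹).val with ht
  set Kcl : ℕ → Finset ℕ := fun p => if (p : ℝ) < z then ({0, t p} : Finset ℕ) else {0} with hKcl
  have hKlt : ∀ p : ℕ, p.Prime → ∀ u ∈ Kcl p, u < p := by
    intro p hp u hu
    haveI : NeZero p := ⟨hp.ne_zero⟩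
    simp only [hKcl] at hu
    split_ifs at hu
    · rcases Finset.mem_insert.1 hu with h | h
      · rw [h]; exact hp.pos
      · rw [Finset.mem_singleton] at h; rw [h]; exact ZMod.val_lt _
    · rw [Finset.mem_singleton] at hu; rw [hu]; exact hp.pos
  have hK01 : ∀ p : ℕ, p.Prime → ∀ u ∈ Kcl p, u = 0 ∨ u = t p := by
    intro p _ u hu
    simp only [hKcl] at hu
    split_ifs at hu
    · rcases Finset.mem_insert.1 hu with h | h
      · exact Or.inl h
      · exact Or.inr (Finset.mem_singleton.1 h)
    · exact Or.inl (Finset.mem_singleton.1 hu)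
  have hK0mem : ∀ p : ℕ, 0 ∈ Kcl p := by
    intro p; simp only [hKcl]; split_ifs <;> simp
  -- Step D: residue classes and the window shift
  have hD1 : ∑ k ∈ (Finset.Ioc K₀ K₁).filter (fun k : ℕ =>
        (∀ p ∈ (d * k - (2 : ℕ)).primeFactors, z ≤ (p : ℝ)) ∧ w ≤ ((d * k).minFac : ℝ)),
        (ArithmeticFunction.liouville k : ℝ) =
      ∑ k ∈ (Finset.Ioc K₀ K₁).filter (fun k : ℕ => ∀ p ∈ Nat.primesBelow ⌈w⌉₊, k % p ∉ Kcl p),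
        (ArithmeticFunction.liouville k : ℝ) := by
    refine Finset.sum_congr (Finset.filter_congr fun k hk => ?_) fun _ _ => rfl
    rw [Finset.mem_Ioc] at hk
    have h3 : 3 ≤ d * k := by
      have := (Nat.div_lt_iff_lt_mul hd0).1 hk.1
      rw [mul_comm] at this; omega
    exact kcond_iff hzw hdw h3
  have hD2 := sum_filter_classes_shift hK (Nat.primesBelow ⌈w⌉₊) Kcl
    (fun p hp => ⟨(Nat.mem_primesBelow.1 hp).2.pos, hKlt p (Nat.mem_primesBelow.1 hp).2⟩)
    (fun k => (ArithmeticFunction.liouville k : ℝ))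
  set Ω : ℕ → Finset ℕ := fun p => (Kcl p).image (fun u : ℕ => (u + (p - K₀ % p)) % p) with hΩ
  -- class properties
  have hΩlt : ∀ p : ℕ, p.Prime → ∀ r ∈ Ω p, r < p := fun p hp =>
    shift_classes_lt hp.pos K₀ (Kcl p)
  have hΩcard : ∀ p : ℕ, p.Prime → #(Ω p) = #(Kcl p) := fun p hp =>
    card_shift_classes hp.pos K₀ (hKlt p hp)
  have hKcard : ∀ p : ℕ, #(Kcl p) ≤ 2 := by
    intro p; simp only [hKcl]; split_ifs
    · exact Finset.card_le_two
    · rw [Finset.card_singleton]; norm_num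
  have hΩle : ∀ p : ℕ, p.Prime → #(Ω p) ≤ 2 := fun p hp => (hΩcard p hp).trans_le (hKcard p)
  have hΩ1 : ∀ p : ℕ, p.Prime → 1 ≤ #(Ω p) := by
    intro p hp; rw [hΩcard p hp, Finset.one_le_card]; exact ⟨0, hK0mem p⟩
  have hΩp : ∀ p : ℕ, p.Prime → #(Ω p) < p := by
    intro p hp
    rw [hΩcard p hp]
    rcases hp.eq_two_or_odd' with rfl | hodd
    · have h2 : Kcl 2 = {0} := by
        simp only [hKcl]
        split_ifs
        · rw [show t 2 = 0 from val_two_mul_inv_two d, Finset.insert_eq_of_mem (Finset.mem_singleton_self 0)]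
        · rfl
      rw [h2, Finset.card_singleton]; norm_num
    · have h3 : 3 ≤ p := by
        have := hp.two_le; rcases hodd with ⟨k, hk⟩; omega
      exact lt_of_le_of_lt (hKcard p) h3
  have hΩ2 : ∀ p ∈ Nat.primesBelow ⌈z⌉₊, p ≠ 2 → 2 ≤ #(Ω p) := by
    intro p hp hp2
    rw [Nat.mem_primesBelow] at hp
    have hpz : (p : ℝ) < z := Nat.lt_ceil.1 hp.1
    rw [hΩcard p hp.2]
    simp only [hKcl]; rw [if_pos hpz]
    have hne : (0 : ℕ) ≠ t p :=
      (val_two_mul_inv_ne_zero hp.2 hp2 (hdw p hp.2 (hpz.trans_le hzw))).symm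
    rw [Finset.card_pair hne]
  -- the weight and the signed sieve
  set σ : ℕ → ℝ := fun r => (ArithmeticFunction.liouville (K₀ + r) : ℝ) with hσ
  have hσ1 : ∀ r, |σ r| ≤ 1 := fun r => abs_liouville_le_one _
  have hmain := hFL (K₁ - K₀) Ω hΩlt hΩle hΩp w L hw2 hwL σ hσ1
  -- `V'`
  have hV0 : 0 ≤ ∏ p ∈ (Finset.range ⌈z⌉₊).filter Nat.Prime, (1 - 1 / (p : ℝ)) :=
    Finset.prod_nonneg fun p hp => by
      have h1 : (1 : ℝ) < p := by exact_mod_cast (Finset.mem_filter.1 hp).2.one_lt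
      rw [sub_nonneg, div_le_one (by linarith)]; exact h1.le
  have hV' : ∏ p ∈ Nat.primesBelow ⌈w⌉₊, (1 - (#(Ω p) : ℝ) / p) ≤
      2 * (∏ p ∈ (Finset.range ⌈z⌉₊).filter Nat.Prime, (1 - 1 / (p : ℝ))) / Real.log w := by
    have h1 := prod_classes_le hz hzw Ω hΩp hΩ1 hΩ2
    have h2 := BombieriSieve.prod_primesBelow_one_sub_inv_le hw1
    calc _ ≤ _ := h1
      _ ≤ 2 * (∏ p ∈ (Finset.range ⌈z⌉₊).filter Nat.Prime, (1 - 1 / (p : ℝ))) *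
          (1 / Real.log w) := mul_le_mul_of_nonneg_left h2 (by positivity)
      _ = _ := by ring
  have hV'0 : 0 ≤ ∏ p ∈ Nat.primesBelow ⌈w⌉₊, (1 - (#(Ω p) : ℝ) / p) :=
    Finset.prod_nonneg fun p hp => by
      have hpp := (Nat.mem_primesBelow.1 hp).2
      have h1 : (#(Ω p) : ℝ) ≤ p := by exact_mod_cast (hΩp p hpp).le
      have hp0 : (0 : ℝ) < p := by exact_mod_cast hpp.pos
      rw [sub_nonneg, div_le_one hp0]; exact h1
  -- `X_d`
  have hX : ((K₁ - K₀ : ℕ) : ℝ) ≤ (x : ℝ) / d + 1 := by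
    have h := natCast_div_sub_div_le (A := 2 * x + 2) (B := x + 2) (q := d) (by omega) hd0
    have e : (((2 * x + 2 : ℕ) : ℝ) - ((x + 2 : ℕ) : ℝ)) / d = (x : ℝ) / d := by
      push_cast; ring
    rw [e] at h; exact h
  -- the remainder
  have hRem := remainder_le hCb hℓ hBV (w := w) hd hK hL1 hK₁r Kcl t hKlt hK01 hlev
  -- combine
  rw [hC1, hC2, abs_mul, hD1, hD2]
  have hlam := abs_liouville_le_one d
  have hE0 : 0 < Real.exp (-(Real.log L / Real.log w)) := Real.exp_pos _
  have hXV : ((K₁ - K₀ : ℕ) : ℝ) * ∏ p ∈ Nat.primesBelow ⌈w⌉₊, (1 - (#(Ω p) : ℝ) / p) ≤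
      ((x : ℝ) / d + 1) * (2 * (∏ p ∈ (Finset.range ⌈z⌉₊).filter Nat.Prime, (1 - 1 / (p : ℝ))) /
        Real.log w) := mul_le_mul hX hV' hV'0 (by positivity)
  have hM : C * ((K₁ - K₀ : ℕ) : ℝ) * (∏ p ∈ Nat.primesBelow ⌈w⌉₊, (1 - (#(Ω p) : ℝ) / p)) *
      Real.exp (-(Real.log L / Real.log w)) ≤
      C * ((x : ℝ) / d + 1) * (2 * (∏ p ∈ (Finset.range ⌈z⌉₊).filter Nat.Prime, (1 - 1 / (p : ℝ))) /
        Real.log w) * Real.exp (-(Real.log L / Real.log w)) := by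
    have := mul_le_mul_of_nonneg_left (mul_le_mul_of_nonneg_right hXV hE0.le) hC
    calc _ = C * ((((K₁ - K₀ : ℕ) : ℝ) * ∏ p ∈ Nat.primesBelow ⌈w⌉₊, (1 - (#(Ω p) : ℝ) / p)) *
        Real.exp (-(Real.log L / Real.log w))) := by ring
      _ ≤ C * (((x : ℝ) / d + 1) * (2 * (∏ p ∈ (Finset.range ⌈z⌉₊).filter Nat.Prime,
          (1 - 1 / (p : ℝ))) / Real.log w) * Real.exp (-(Real.log L / Real.log w))) := this
      _ = _ := by ring
  calc _ ≤ 1 * |∑ r ∈ (Finset.Icc 1 (K₁ - K₀)).filter (fun r : ℕ => ∀ p ∈ Nat.primesBelow ⌈w⌉₊,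
          r % p ∉ (Kcl p).image (fun u : ℕ => (u + (p - K₀ % p)) % p)),
          (ArithmeticFunction.liouville (K₀ + r) : ℝ)| :=
        mul_le_mul_of_nonneg_right hlam (abs_nonneg _)
    _ ≤ _ := by rw [one_mul]; exact hmain.trans (by linarith [hM, hRem])

end Summit.Parity.GeneralizedHardyLittlewood.Theorems.ParityLeakOneFifth
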